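import Literature.NumberTheory.EllipticCurves.ComplexTorus
import Mathlib.Analysis.Calculus.Deriv.Polynomial
import Mathlib.Topology.Algebra.Module.Cardinality
import HarnessLib

/-!
# Complex multiplication of a lattice from a rational transformation of `℘`

Topic `NumberTheory/EllipticCurves`; analytic layer below the CM-period leaf
`Literature.NumberTheory.EllipticCurves.exists_isCMPeriod_of_j_mem_maximalCMJInvariants` (Coates–Wiles 1977, §1 p. 225) of
`Literature/…/ComplexMultiplicationCoatesWiles.lean`, via the table of singular moduli
(`Literature/…/ComplexMultiplicationSingularModuli.lean`).  Everything here is **proved**.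

Let `Λ ⊂ ℂ` be a lattice (a Mathlib `PeriodPair` `L`), `℘ = ℘_Λ`, `f(x) = 4x³ − g₂x − g₃`, so
that `℘'² = f(℘)` and `℘'' = 6℘² − g₂/2`.  If `αΛ ⊆ Λ` for some `α ∈ ℂ ∖ ℤ` (complex
multiplication), then classically `℘(αz) = R(℘(z))` for a rational function `R = P/Q`
(Weber, *Lehrbuch der Algebra* III, §§ 114–115; Silverman, *Advanced Topics*, II.2), and
`u = R(℘)` visibly satisfies `u'² = α²f(u)`, `u'' = α²(6u² − g₂/2)`, i.e. the polynomial
identities `(H1)` `f·(P'Q − PQ')² = α²·(4P³ − g₂PQ² − g₃Q³)·Q` and `(H2)`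
`2[(P''Q − PQ'')Q − 2Q'(P'Q − PQ')]f + (P'Q − PQ')Q(12X² − g₂) = α²(12P²Q − g₂Q³)`.

The main theorem of this file is the **converse**, which turns such a pair `(P, Q)` into a
certificate of complex multiplication:

* `PeriodPair.mul_mem_lattice_of_transformation` : if `α ≠ 0`, `Q ≠ 0` and `P, Q ∈ ℂ[X]` satisfy
  `(H1)` and `(H2)` with `g₂ = g₂(Λ)`, `g₃ = g₃(Λ)`, then `αΛ ⊆ Λ`.

Proof (classical uniqueness for the Weierstrass equation, cf. Whittaker–Watson §20.22 and the
tree's `PeriodPair.sub_mem_lattice_of_weierstrassP_eq`, whose architecture is followed): at a point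
`z₀ ∉ Λ` with `Q(℘(z₀)) ≠ 0` put `u = (P/Q)(℘)`; by `(H1)` the pair `(u(z₀), u'(z₀)/α)` lies on
`y² = f(x)`, so it is `(℘(c), ℘'(c))` for some `c ∉ Λ` (`℘` takes every value,
`PeriodPair.exists_weierstrassP_eq`, and `℘'` is odd).  By `(H2)`, along real `t` both
`(u(z₀ + t), u'(z₀ + t)/α)` and `(℘(c + αt), ℘'(c + αt))` solve `Y' = α·(Y₂, 6Y₁² − g₂/2)` with
the same initial value, hence agree for small `t` (Mathlib `ODE_solution_unique_of_eventually`),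
so `P(℘(ζ)) = ℘(c + α(ζ − z₀))·Q(℘(ζ))` near `z₀` and then on the connected co-countable open set
where both sides are analytic (identity theorem).  Since the left side is `Λ`-periodic,
`℘(αl + w) = ℘(w)` for `l ∈ Λ` on an open set, hence wherever both sides are analytic, and
comparing the pole of `℘` at `0` with `℘(αl)` gives `αl ∈ Λ`.

Also proved and exported: `PeriodPair.mem_lattice_of_weierstrassP_add_eventuallyEq` (a complex
number `β` with `℘(β + w) = ℘(w)` near one point is a period).

## References

* E. T. Whittaker, G. N. Watson, *A Course of Modern Analysis*, 4th ed., CUP 1927, §20.22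
  (`℘'' = 6℘² − g₂/2`), §20.3 (periods of `℘`).
* H. Weber, *Lehrbuch der Algebra*, Bd. III, 2. Aufl., Vieweg 1908, §§ 114–115 (complex
  multiplication of `℘`).
* J. H. Silverman, *Advanced Topics in the Arithmetic of Elliptic Curves*, GTM 151, Springer
  1994, Prop. II.1.1, §II.2; *The Arithmetic of Elliptic Curves*, 2nd ed., GTM 106, Prop. VI.3.6.
-/

noncomputable section

open Complex Filter Topology Bornology Set Polynomial

namespace PeriodPair

variable (L : PeriodPair)

/-! ### Periods from a local coincidence `℘(β + w) = ℘(w)` -/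

/-- **A local translation symmetry of `℘` is a period.**  If `℘(β + w) = ℘(w)` for all `w` near
some `w₁` with `w₁, β + w₁ ∉ Λ`, then `β ∈ Λ`: the two sides agree on the connected open set
`{w | w ∉ Λ, β + w ∉ Λ}` (identity theorem), and if `β ∉ Λ` the right side has a pole at `w = 0`
while the left side is continuous there (Whittaker–Watson §20.3: the periods of `℘` are exactly
the points of `Λ`). [folklore] -/
theorem mem_lattice_of_weierstrassP_add_eventuallyEq {β w₁ : ℂ} (hw₁ : w₁ ∉ L.lattice)
    (hw₁' : β + w₁ ∉ L.lattice) (h : ∀ᶠ w in 𝓝 w₁, ℘[L] (β + w) = ℘[L] w) :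
    β ∈ L.lattice := by
  have hopen : IsOpen ((L.lattice : Set ℂ)ᶜ) := L.isClosed_lattice.isOpen_compl
  set F₁ : ℂ → ℂ := fun w ↦ ℘[L] (β + w) with hF₁
  set U : Set ℂ := {w | w ∉ L.lattice ∧ β + w ∉ L.lattice} with hU
  have hUeq : U = ((L.lattice : Set ℂ) ∪ (fun l : ℂ ↦ l - β) '' (L.lattice : Set ℂ))ᶜ := by
    ext w
    simp only [hU, mem_setOf_eq, mem_compl_iff, mem_union, mem_image, SetLike.mem_coe, not_or,
      not_exists, not_and]
    constructor
    · rintro ⟨h1, h2⟩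
      exact ⟨h1, fun l hl h ↦ h2 (by rw [← h]; simpa using hl)⟩
    · rintro ⟨h1, h2⟩
      exact ⟨h1, fun h ↦ h2 _ h (by ring)⟩
  have hUpre : IsPreconnected U := by
    rw [hUeq]
    exact (Set.Countable.isConnected_compl_of_one_lt_rank (by simp)
      (L.countable_lattice.union (L.countable_lattice.image _))).isPreconnected
  have hF₁an : AnalyticOnNhd ℂ F₁ U := fun w hw ↦
    (L.analyticOnNhd_weierstrassP (β + w) hw.2).comp (by fun_prop)
  have hF₂an : AnalyticOnNhd ℂ ℘[L] U := fun w hw ↦ L.analyticOnNhd_weierstrassP w hw.1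
  have hw₁U : w₁ ∈ U := ⟨hw₁, hw₁'⟩
  have hfreq : ∃ᶠ w in 𝓝[≠] w₁, F₁ w = ℘[L] w :=
    ((h.filter_mono nhdsWithin_le_nhds).frequently)
  have hEq : EqOn F₁ ℘[L] U :=
    hF₁an.eqOn_of_preconnected_of_frequently_eq hF₂an hUpre hw₁U hfreq
  by_contra hβ
  -- compare the pole of `℘` at `0` with the continuity of `F₁` at `0`
  have hF₁c : Tendsto F₁ (𝓝[≠] 0) (𝓝 (F₁ 0)) := by
    have hd : DifferentiableAt ℂ ℘[L] (β + 0) :=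
      L.differentiableOn_weierstrassP.differentiableAt (hopen.mem_nhds (by simpa using hβ))
    have hf : ContinuousAt (fun w : ℂ ↦ β + w) 0 := by fun_prop
    have : ContinuousAt F₁ 0 := hd.continuousAt.comp hf
    exact this.continuousWithinAt.tendsto
  have h℘ : Tendsto ℘[L] (𝓝[≠] 0) (cobounded ℂ) :=
    tendsto_cobounded_of_meromorphicOrderAt_neg (by
      rw [L.order_weierstrassP 0 (zero_mem _)]; decide)
  have hEq' : ℘[L] =ᶠ[𝓝[≠] 0] F₁ := by
    have h1 : ∀ᶠ w in 𝓝[≠] (0 : ℂ), w ∉ L.lattice := L.eventually_nhdsNE_notMem_lattice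
    have h2 : ∀ᶠ w in 𝓝[≠] (0 : ℂ), β + w ∉ L.lattice := by
      have hc : Continuous fun w : ℂ ↦ β + w := by fun_prop
      have : (fun w : ℂ ↦ β + w) ⁻¹' (L.lattice : Set ℂ)ᶜ ∈ 𝓝 (0 : ℂ) :=
        hc.continuousAt.preimage_mem_nhds (hopen.mem_nhds (by simpa using hβ))
      exact mem_nhdsWithin_of_mem_nhds this
    filter_upwards [h1, h2] with w hw1 hw2 using (hEq ⟨hw1, hw2⟩).symm
  exact (hF₁c.congr' hEq'.symm).not_tendsto (Metric.disjoint_nhds_cobounded _) h℘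

/-! ### The transformation `u = (P/Q)(℘)` and its derivatives -/

section Transformation

variable {L}
variable {α : ℂ} {P Q : ℂ[X]}

/-- `u = P(℘)/Q(℘)` has derivative `u' = D(℘)·℘'/Q(℘)²`, `D = P'Q − PQ'`, off `Λ` where
`Q(℘) ≠ 0`. [folklore] -/
lemma hasDerivAt_rationalMap_weierstrassP {z : ℂ} (hz : z ∉ L.lattice)
    (hQ : Q.eval (℘[L] z) ≠ 0) :
    HasDerivAt (fun w ↦ P.eval (℘[L] w) / Q.eval (℘[L] w))
      ((derivative P * Q - P * derivative Q).eval (℘[L] z) * ℘'[L] z / Q.eval (℘[L] z) ^ 2)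
      z := by
  have hP : HasDerivAt (fun w ↦ P.eval (℘[L] w)) ((derivative P).eval (℘[L] z) * ℘'[L] z) z :=
    (P.hasDerivAt (℘[L] z)).comp z (hasDerivAt_weierstrassP hz)
  have hQ' : HasDerivAt (fun w ↦ Q.eval (℘[L] w)) ((derivative Q).eval (℘[L] z) * ℘'[L] z) z :=
    (Q.hasDerivAt (℘[L] z)).comp z (hasDerivAt_weierstrassP hz)
  refine (hP.div hQ' hQ).congr_deriv ?_
  simp only [eval_sub, eval_mul]
  ring

/-- `u' = D(℘)℘'/Q(℘)²` has derivative
`u'' = ([D'(℘)℘'² + D(℘)(6℘² − g₂/2)] Q(℘)² − D(℘)℘'·2Q(℘)Q'(℘)℘') / Q(℘)⁴` off `Λ` where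
`Q(℘) ≠ 0` (using `℘'' = 6℘² − g₂/2`). [folklore] -/
lemma hasDerivAt_rationalMap_weierstrassP_deriv {z : ℂ} (hz : z ∉ L.lattice)
    (hQ : Q.eval (℘[L] z) ≠ 0) :
    HasDerivAt
      (fun w ↦ (derivative P * Q - P * derivative Q).eval (℘[L] w) * ℘'[L] w /
        Q.eval (℘[L] w) ^ 2)
      ((((derivative (derivative P * Q - P * derivative Q)).eval (℘[L] z) * ℘'[L] z * ℘'[L] z +
        (derivative P * Q - P * derivative Q).eval (℘[L] z) * (6 * ℘[L] z ^ 2 - L.g₂ / 2)) *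
          Q.eval (℘[L] z) ^ 2 -
        (derivative P * Q - P * derivative Q).eval (℘[L] z) * ℘'[L] z *
          (2 * Q.eval (℘[L] z) * ((derivative Q).eval (℘[L] z) * ℘'[L] z))) /
        (Q.eval (℘[L] z) ^ 2) ^ 2) z := by
  have hD : HasDerivAt (fun w ↦ (derivative P * Q - P * derivative Q).eval (℘[L] w))
      ((derivative (derivative P * Q - P * derivative Q)).eval (℘[L] z) * ℘'[L] z) z :=
    ((derivative P * Q - P * derivative Q).hasDerivAt (℘[L] z)).comp z (hasDerivAt_weierstrassP hz)
  have hQ' : HasDerivAt (fun w ↦ Q.eval (℘[L] w)) ((derivative Q).eval (℘[L] z) * ℘'[L] z) z :=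
    (Q.hasDerivAt (℘[L] z)).comp z (hasDerivAt_weierstrassP hz)
  have hnum : HasDerivAt (fun w ↦ (derivative P * Q - P * derivative Q).eval (℘[L] w) * ℘'[L] w)
      ((derivative (derivative P * Q - P * derivative Q)).eval (℘[L] z) * ℘'[L] z * ℘'[L] z +
        (derivative P * Q - P * derivative Q).eval (℘[L] z) * (6 * ℘[L] z ^ 2 - L.g₂ / 2)) z :=
    hD.mul (L.hasDerivAt_derivWeierstrassP hz)
  have hden : HasDerivAt (fun w ↦ Q.eval (℘[L] w) ^ 2)
      (2 * Q.eval (℘[L] z) * ((derivative Q).eval (℘[L] z) * ℘'[L] z)) z := by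
    have h2 : HasDerivAt (fun w ↦ Q.eval (℘[L] w) * Q.eval (℘[L] w))
        ((derivative Q).eval (℘[L] z) * ℘'[L] z * Q.eval (℘[L] z) +
          Q.eval (℘[L] z) * ((derivative Q).eval (℘[L] z) * ℘'[L] z)) z := hQ'.mul hQ'
    simp only [← pow_two] at h2
    refine h2.congr_deriv ?_
    ring
  exact hnum.div hden (pow_ne_zero 2 hQ)

/-- **The first-order relation** `(u'/α)² = f(u)` for `u = (P/Q)(℘)`, from `(H1)` and
`℘'² = f(℘)`. [folklore] -/
lemma rationalMap_weierstrassP_deriv_sq (hα : α ≠ 0)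
    (h1 : (C 4 * X ^ 3 - C L.g₂ * X - C L.g₃) * (derivative P * Q - P * derivative Q) ^ 2 =
      C (α ^ 2) * ((C 4 * P ^ 3 - C L.g₂ * P * Q ^ 2 - C L.g₃ * Q ^ 3) * Q))
    {z : ℂ} (hz : z ∉ L.lattice) (hQ : Q.eval (℘[L] z) ≠ 0) :
    ((derivative P * Q - P * derivative Q).eval (℘[L] z) * ℘'[L] z / Q.eval (℘[L] z) ^ 2 / α) ^ 2 =
      4 * (P.eval (℘[L] z) / Q.eval (℘[L] z)) ^ 3 - L.g₂ * (P.eval (℘[L] z) / Q.eval (℘[L] z)) -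
        L.g₃ := by
  have hsq := L.derivWeierstrassP_sq z hz
  have h1z := congrArg (eval (℘[L] z)) h1
  simp only [eval_mul, eval_sub, eval_pow, eval_C, eval_X] at h1z
  simp only [eval_sub, eval_mul]
  set x := ℘[L] z with hx
  set y := ℘'[L] z with hy
  set p := P.eval x with hp
  set q := Q.eval x with hq
  set p₁ := (derivative P).eval x with hp₁
  set q₁ := (derivative Q).eval x with hq₁
  have key : ((p₁ * q - p * q₁) * y) ^ 2 * q ^ 3 =
      (4 * p ^ 3 - L.g₂ * p * q ^ 2 - L.g₃ * q ^ 3) * (q ^ 2 * α) ^ 2 := by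
    linear_combination q ^ 3 * h1z + (p₁ * q - p * q₁) ^ 2 * q ^ 3 * hsq
  have hr : 4 * (p / q) ^ 3 - L.g₂ * (p / q) - L.g₃ =
      (4 * p ^ 3 - L.g₂ * p * q ^ 2 - L.g₃ * q ^ 3) / q ^ 3 := by
    field_simp
  rw [div_div, div_pow, div_eq_iff (pow_ne_zero _ (mul_ne_zero (pow_ne_zero _ hQ) hα)), hr,
    div_mul_eq_mul_div, eq_div_iff (pow_ne_zero 3 hQ)]
  exact key

/-- **The second-order relation** `u'' = α²(6u² − g₂/2)` for `u = (P/Q)(℘)`, from `(H2)` and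
`℘'² = f(℘)`. [folklore] -/
lemma rationalMap_weierstrassP_deriv_deriv_eq
    (h2 : C 2 * ((((derivative (derivative P)) * Q - P * derivative (derivative Q)) * Q -
        C 2 * (derivative Q * (derivative P * Q - P * derivative Q))) *
        (C 4 * X ^ 3 - C L.g₂ * X - C L.g₃)) +
      (derivative P * Q - P * derivative Q) * Q * (C 12 * X ^ 2 - C L.g₂) =
      C (α ^ 2) * (C 12 * P ^ 2 * Q - C L.g₂ * Q ^ 3))
    {z : ℂ} (hz : z ∉ L.lattice) (hQ : Q.eval (℘[L] z) ≠ 0) :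
    (((derivative (derivative P * Q - P * derivative Q)).eval (℘[L] z) * ℘'[L] z * ℘'[L] z +
        (derivative P * Q - P * derivative Q).eval (℘[L] z) * (6 * ℘[L] z ^ 2 - L.g₂ / 2)) *
          Q.eval (℘[L] z) ^ 2 -
        (derivative P * Q - P * derivative Q).eval (℘[L] z) * ℘'[L] z *
          (2 * Q.eval (℘[L] z) * ((derivative Q).eval (℘[L] z) * ℘'[L] z))) /
        (Q.eval (℘[L] z) ^ 2) ^ 2 =
      α ^ 2 * (6 * (P.eval (℘[L] z) / Q.eval (℘[L] z)) ^ 2 - L.g₂ / 2) := by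
  have hsq := L.derivWeierstrassP_sq z hz
  have h2z := congrArg (eval (℘[L] z)) h2
  simp only [eval_mul, eval_add, eval_sub, eval_pow, eval_C, eval_X] at h2z
  have hD' : (derivative (derivative P * Q - P * derivative Q)).eval (℘[L] z) =
      (derivative (derivative P)).eval (℘[L] z) * Q.eval (℘[L] z) -
        P.eval (℘[L] z) * (derivative (derivative Q)).eval (℘[L] z) := by
    simp only [derivative_sub, derivative_mul, eval_sub, eval_add, eval_mul]
    ring
  rw [hD']
  simp only [eval_sub, eval_mul]
  set x := ℘[L] z with hx
  set y := ℘'[L] z with hy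
  set p := P.eval x with hp
  set q := Q.eval x with hq
  set p₁ := (derivative P).eval x with hp₁
  set q₁ := (derivative Q).eval x with hq₁
  set p₂ := (derivative (derivative P)).eval x with hp₂
  set q₂ := (derivative (derivative Q)).eval x with hq₂
  have key : ((p₂ * q - p * q₂) * y * y + (p₁ * q - p * q₁) * (6 * x ^ 2 - L.g₂ / 2)) * q ^ 2 -
      (p₁ * q - p * q₁) * y * (2 * q * (q₁ * y)) =
      α ^ 2 * (6 * p ^ 2 - L.g₂ / 2 * q ^ 2) * q ^ 2 := by
    linear_combination (q / 2) * h2z + ((p₂ * q - p * q₂) * q ^ 2 -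
      2 * (p₁ * q - p * q₁) * q * q₁) * hsq
  have hr : α ^ 2 * (6 * (p / q) ^ 2 - L.g₂ / 2) =
      α ^ 2 * (6 * p ^ 2 - L.g₂ / 2 * q ^ 2) * q ^ 2 / (q ^ 2) ^ 2 := by
    field_simp
  rw [hr]
  exact congrArg (· / (q ^ 2) ^ 2) key

end Transformation

/-! ### The main theorem -/

/-- **Complex multiplication from a rational transformation of `℘`.**  Let `Λ` be a lattice with
invariants `g₂, g₃`, `f = 4X³ − g₂X − g₃`, and let `α ∈ ℂˣ`, `P, Q ∈ ℂ[X]`, `Q ≠ 0`, satisfy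
`(H1)` `f·(P'Q − PQ')² = α²(4P³ − g₂PQ² − g₃Q³)Q` and
`(H2)` `2[(P''Q − PQ'')Q − 2Q'(P'Q − PQ')]f + (P'Q − PQ')Q(12X² − g₂) = α²(12P²Q − g₂Q³)` — the
polynomial form of "`u = (P/Q)(℘_Λ)` satisfies `u'² = α²f(u)` and `u'' = α²(6u² − g₂/2)`", as the
transformation `℘(αz) = (P/Q)(℘(z))` of a lattice with complex multiplication by `α` does
(Weber, *Algebra* III §§ 114–115; Silverman, *Advanced Topics* II.2).  Then `αΛ ⊆ Λ`.
See the module docstring for the proof (ODE uniqueness, analytic continuation, poles).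
[folklore] -/
theorem mul_mem_lattice_of_transformation {α : ℂ} (hα : α ≠ 0) {P Q : ℂ[X]} (hQ0 : Q ≠ 0)
    (h1 : (C 4 * X ^ 3 - C L.g₂ * X - C L.g₃) * (derivative P * Q - P * derivative Q) ^ 2 =
      C (α ^ 2) * ((C 4 * P ^ 3 - C L.g₂ * P * Q ^ 2 - C L.g₃ * Q ^ 3) * Q))
    (h2 : C 2 * ((((derivative (derivative P)) * Q - P * derivative (derivative Q)) * Q -
        C 2 * (derivative Q * (derivative P * Q - P * derivative Q))) *
        (C 4 * X ^ 3 - C L.g₂ * X - C L.g₃)) +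
      (derivative P * Q - P * derivative Q) * Q * (C 12 * X ^ 2 - C L.g₂) =
      C (α ^ 2) * (C 12 * P ^ 2 * Q - C L.g₂ * Q ^ 3))
    {l : ℂ} (hl : l ∈ L.lattice) : α * l ∈ L.lattice := by
  have hopen : IsOpen ((L.lattice : Set ℂ)ᶜ) := L.isClosed_lattice.isOpen_compl
  -- Step 0: a base point `z₀ ∉ Λ` with `Q(℘(z₀)) ≠ 0`
  obtain ⟨x₀, hx₀⟩ : ∃ x₀ : ℂ, Q.eval x₀ ≠ 0 := by
    by_contra! H
    exact hQ0 (Polynomial.funext fun x ↦ by rw [H x, eval_zero])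
  obtain ⟨z₀, hz₀, hz₀x⟩ := L.exists_weierstrassP_eq x₀
  have hQz₀ : Q.eval (℘[L] z₀) ≠ 0 := by rwa [hz₀x]
  -- Step 1: initial data `(u(z₀), u'(z₀)/α) = (℘(c), ℘'(c))`
  -- `u = P(℘)/Q(℘)` and `u' = D(℘)℘'/Q(℘)²`, `D = P'Q - PQ'`
  set u : ℂ → ℂ := fun w ↦ P.eval (℘[L] w) / Q.eval (℘[L] w) with hu
  set u' : ℂ → ℂ := fun w ↦
    (derivative P * Q - P * derivative Q).eval (℘[L] w) * ℘'[L] w / Q.eval (℘[L] w) ^ 2 with hu'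
  obtain ⟨c, hc, hcu, hcu'⟩ : ∃ c ∉ L.lattice, ℘[L] c = u z₀ ∧ ℘'[L] c = u' z₀ / α := by
    obtain ⟨c₀, hc₀, hc₀u⟩ := L.exists_weierstrassP_eq (u z₀)
    have hsq : ℘'[L] c₀ ^ 2 = (u' z₀ / α) ^ 2 := by
      rw [L.derivWeierstrassP_sq c₀ hc₀, hc₀u, hu, hu',
        rationalMap_weierstrassP_deriv_sq hα h1 hz₀ hQz₀]
    rcases sq_eq_sq_iff_eq_or_eq_neg.mp hsq with h | h
    · exact ⟨c₀, hc₀, hc₀u, h⟩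
    · refine ⟨-c₀, fun h' ↦ hc₀ (by simpa using neg_mem h'), ?_, ?_⟩
      · rw [L.weierstrassP_neg, hc₀u]
      · rw [L.derivWeierstrassP_neg, h, neg_neg]
  -- Step 2: local agreement along real `t` by ODE uniqueness for `Y' = α (Y₂, 6Y₁² - g₂/2)`
  set Y₁ : ℝ → ℂ × ℂ := fun s ↦ (u (z₀ + s), u' (z₀ + s) / α) with hY₁
  set Y₂ : ℝ → ℂ × ℂ := fun s ↦ (℘[L] (c + α * s), ℘'[L] (c + α * s)) with hY₂
  have hY0 : Y₁ 0 = Y₂ 0 := by simp [hY₁, hY₂, hcu, hcu']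
  obtain ⟨K, S, hS, hK⟩ := ((L.contDiff_weierstrassField.const_smul α).contDiffAt
    (x := (℘[L] c, ℘'[L] c))).exists_lipschitzOnWith
  have hz_ev : ∀ᶠ s : ℝ in 𝓝 0, z₀ + (s : ℂ) ∉ L.lattice ∧ Q.eval (℘[L] (z₀ + s)) ≠ 0 := by
    have hc1 : Continuous fun s : ℝ ↦ z₀ + (s : ℂ) := by fun_prop
    have h1 : (fun s : ℝ ↦ z₀ + (s : ℂ)) ⁻¹' (L.lattice : Set ℂ)ᶜ ∈ 𝓝 (0 : ℝ) :=
      hc1.continuousAt.preimage_mem_nhds (hopen.mem_nhds (by simpa using hz₀))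
    have hc2 : ContinuousAt (fun s : ℝ ↦ Q.eval (℘[L] (z₀ + (s : ℂ)))) 0 := by
      have ha : ContinuousAt (fun s : ℝ ↦ z₀ + (s : ℂ)) 0 := hc1.continuousAt
      have hb : ContinuousAt ℘[L] ((fun s : ℝ ↦ z₀ + (s : ℂ)) 0) :=
        (L.analyticOnNhd_weierstrassP _ (by simpa using hz₀)).continuousAt
      have hc : ContinuousAt (fun s : ℝ ↦ ℘[L] (z₀ + (s : ℂ))) 0 :=
        ContinuousAt.comp (g := ℘[L]) (f := fun s : ℝ ↦ z₀ + (s : ℂ)) (x := 0) hb ha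
      exact ContinuousAt.comp (g := fun x ↦ Q.eval x) (f := fun s : ℝ ↦ ℘[L] (z₀ + (s : ℂ)))
        (x := 0) Q.continuous.continuousAt hc
    have h2 : ∀ᶠ s : ℝ in 𝓝 0, Q.eval (℘[L] (z₀ + (s : ℂ))) ≠ 0 :=
      hc2.eventually_ne (by simpa using hQz₀)
    filter_upwards [h1, h2] with s hs1 hs2 using ⟨hs1, hs2⟩
  have hc_ev : ∀ᶠ s : ℝ in 𝓝 0, c + α * (s : ℂ) ∉ L.lattice := by
    have hc1 : Continuous fun s : ℝ ↦ c + α * (s : ℂ) := by fun_prop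
    have : (fun s : ℝ ↦ c + α * (s : ℂ)) ⁻¹' (L.lattice : Set ℂ)ᶜ ∈ 𝓝 (0 : ℝ) :=
      hc1.continuousAt.preimage_mem_nhds (hopen.mem_nhds (by simpa using hc))
    filter_upwards [this] with s hs using hs
  have hY₁d : ∀ᶠ s : ℝ in 𝓝 0, HasDerivAt Y₁ (α • L.weierstrassField (Y₁ s)) s := by
    filter_upwards [hz_ev] with s hs
    have hd1 : HasDerivAt (fun r : ℝ ↦ u (z₀ + r)) (u' (z₀ + s)) s :=
      (HasDerivAt.comp_const_add z₀ (s : ℂ)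
        (hasDerivAt_rationalMap_weierstrassP hs.1 hs.2)).comp_ofReal
    have hd2 : HasDerivAt (fun r : ℝ ↦ u' (z₀ + r) / α) (_ / α) s :=
      (HasDerivAt.comp_const_add z₀ (s : ℂ)
        (hasDerivAt_rationalMap_weierstrassP_deriv hs.1 hs.2)).comp_ofReal.div_const α
    refine (hd1.prodMk hd2).congr_deriv ?_
    simp only [hY₁, hu, hu', weierstrassField, Prod.smul_mk, smul_eq_mul, Prod.mk.injEq]
    refine ⟨by field_simp, ?_⟩
    rw [rationalMap_weierstrassP_deriv_deriv_eq h2 hs.1 hs.2]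
    field_simp
  have hY₂d : ∀ᶠ s : ℝ in 𝓝 0, HasDerivAt Y₂ (α • L.weierstrassField (Y₂ s)) s := by
    filter_upwards [hc_ev] with s hs
    have e1 : HasDerivAt (fun r : ℂ ↦ c + α * r) α (s : ℂ) := by
      simpa using ((hasDerivAt_id (s : ℂ)).const_mul α).const_add c
    have hd1 : HasDerivAt (fun r : ℝ ↦ ℘[L] (c + α * r)) (℘'[L] (c + α * s) * α) s := by
      have h' : HasDerivAt (fun r : ℂ ↦ ℘[L] (c + α * r)) (℘'[L] (c + α * s) * α) s :=
        HasDerivAt.comp (h₂ := ℘[L]) (h := fun r : ℂ ↦ c + α * r) (s : ℂ)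
          (hasDerivAt_weierstrassP hs) e1
      exact h'.comp_ofReal
    have hd2 : HasDerivAt (fun r : ℝ ↦ ℘'[L] (c + α * r))
        ((6 * ℘[L] (c + α * s) ^ 2 - L.g₂ / 2) * α) s := by
      have h' : HasDerivAt (fun r : ℂ ↦ ℘'[L] (c + α * r))
          ((6 * ℘[L] (c + α * s) ^ 2 - L.g₂ / 2) * α) s :=
        HasDerivAt.comp (h₂ := ℘'[L]) (h := fun r : ℂ ↦ c + α * r) (s : ℂ)
          (L.hasDerivAt_derivWeierstrassP hs) e1
      exact h'.comp_ofReal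
    refine (hd1.prodMk hd2).congr_deriv ?_
    simp only [hY₂, weierstrassField, Prod.smul_mk, smul_eq_mul, Prod.mk.injEq]
    exact ⟨by ring, by ring⟩
  have hY₁S : ∀ᶠ s : ℝ in 𝓝 0, Y₁ s ∈ S := by
    have hcont : ContinuousAt Y₁ 0 := (hY₁d.self_of_nhds).continuousAt
    refine hcont.preimage_mem_nhds ?_
    have : Y₁ 0 = (℘[L] c, ℘'[L] c) := by simp [hY₁, hcu, hcu']
    rwa [this]
  have hY₂S : ∀ᶠ s : ℝ in 𝓝 0, Y₂ s ∈ S := by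
    have hcont : ContinuousAt Y₂ 0 := (hY₂d.self_of_nhds).continuousAt
    refine hcont.preimage_mem_nhds ?_
    have : Y₂ 0 = (℘[L] c, ℘'[L] c) := by simp [hY₂]
    rwa [this]
  have hloc : Y₁ =ᶠ[𝓝 0] Y₂ :=
    ODE_solution_unique_of_eventually (v := fun _ Y ↦ α • L.weierstrassField Y) (s := fun _ ↦ S)
      (Eventually.of_forall fun _ ↦ hK) (hY₁d.and hY₁S) (hY₂d.and hY₂S) hY0
  -- Step 3: `P(℘ ζ) = ℘(c' + α ζ) Q(℘ ζ)` on `V = {ζ ∉ Λ, c' + αζ ∉ Λ}`, `c' = c - α z₀`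
  set c' : ℂ := c - α * z₀ with hc'
  set G : ℂ → ℂ := fun ζ ↦ P.eval (℘[L] ζ) - ℘[L] (c' + α * ζ) * Q.eval (℘[L] ζ) with hG
  set V : Set ℂ := {ζ | ζ ∉ L.lattice ∧ c' + α * ζ ∉ L.lattice} with hV
  have hVeq : V = ((L.lattice : Set ℂ) ∪
      (fun m : ℂ ↦ (m - c') / α) '' (L.lattice : Set ℂ))ᶜ := by
    ext ζ
    simp only [hV, mem_setOf_eq, mem_compl_iff, mem_union, mem_image, SetLike.mem_coe, not_or,
      not_exists, not_and]
    constructor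
    · rintro ⟨h1, h2⟩
      refine ⟨h1, fun m hm h ↦ h2 ?_⟩
      have e : c' + α * ((m - c') / α) = m := by field_simp; ring
      rw [← h, e]
      exact hm
    · rintro ⟨h1, h2⟩
      refine ⟨h1, fun h ↦ h2 _ h ?_⟩
      field_simp
      ring
  have hVopen : IsOpen V :=
    (hopen.preimage continuous_id).inter (hopen.preimage (by fun_prop))
  have hVcount : Vᶜ.Countable := by
    rw [hVeq, compl_compl]
    exact L.countable_lattice.union (L.countable_lattice.image _)
  have hVpre : IsPreconnected V := by
    rw [hVeq]
    exact (Set.Countable.isConnected_compl_of_one_lt_rank (by simp)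
      (L.countable_lattice.union (L.countable_lattice.image _))).isPreconnected
  have hGan : AnalyticOnNhd ℂ G V := by
    refine DifferentiableOn.analyticOnNhd (fun ζ hζ ↦ ?_) hVopen
    have h℘1 : DifferentiableAt ℂ ℘[L] ζ :=
      L.differentiableOn_weierstrassP.differentiableAt (hopen.mem_nhds hζ.1)
    have h℘2 : DifferentiableAt ℂ (fun ζ : ℂ ↦ ℘[L] (c' + α * ζ)) ζ := by
      have hi : DifferentiableAt ℂ (fun ζ : ℂ ↦ c' + α * ζ) ζ := by fun_prop
      exact (L.differentiableOn_weierstrassP.differentiableAt (hopen.mem_nhds hζ.2)).comp ζ hi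
    have hP : DifferentiableAt ℂ (fun ζ ↦ P.eval (℘[L] ζ)) ζ := P.differentiableAt.comp ζ h℘1
    have hQ : DifferentiableAt ℂ (fun ζ ↦ Q.eval (℘[L] ζ)) ζ := Q.differentiableAt.comp ζ h℘1
    exact (hP.sub (h℘2.mul hQ)).differentiableWithinAt
  have hz₀V : z₀ ∈ V := ⟨hz₀, by simpa [hc'] using hc⟩
  have hGfreq : ∃ᶠ ζ in 𝓝[≠] z₀, G ζ = (fun _ ↦ (0 : ℂ)) ζ := by
    have hreal : ∀ᶠ s : ℝ in 𝓝[≠] 0, G (z₀ + s) = 0 := by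
      filter_upwards [mem_nhdsWithin_of_mem_nhds (hloc.and hz_ev)] with s hs
      have e1 : u (z₀ + s) = ℘[L] (c + α * s) := by
        simpa [hY₁, hY₂] using congrArg Prod.fst hs.1
      have e2 : c' + α * (z₀ + (s : ℂ)) = c + α * s := by rw [hc']; ring
      simp only [hG, e2, ← e1, hu]
      field_simp [hs.2.2]
      ring
    have htend : Tendsto (fun s : ℝ ↦ z₀ + (s : ℂ)) (𝓝[≠] 0) (𝓝[≠] z₀) := by
      refine tendsto_nhdsWithin_of_tendsto_nhds_of_eventually_within _ ?_ ?_
      · have hc1 : Continuous fun s : ℝ ↦ z₀ + (s : ℂ) := by fun_prop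
        have h := hc1.tendsto 0
        simp only [ofReal_zero, add_zero] at h
        exact h.mono_left nhdsWithin_le_nhds
      · filter_upwards [self_mem_nhdsWithin] with s (hs : s ≠ 0)
        simpa using hs
    exact htend.frequently hreal.frequently
  have hGV : EqOn G (fun _ ↦ (0 : ℂ)) V :=
    hGan.eqOn_of_preconnected_of_frequently_eq analyticOnNhd_const hVpre hz₀V hGfreq
  -- Step 4: periodicity gives `℘(α l + w) = ℘(w)` near a point
  set O : Set ℂ := {ζ | ζ ∉ L.lattice ∧ Q.eval (℘[L] ζ) ≠ 0} with hO
  have hOopen : IsOpen O := by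
    rw [isOpen_iff_mem_nhds]
    rintro ζ ⟨hζ, hζQ⟩
    have h℘c : ContinuousAt ℘[L] ζ := (L.analyticOnNhd_weierstrassP ζ hζ).continuousAt
    have h2 : ∀ᶠ ξ in 𝓝 ζ, Q.eval (℘[L] ξ) ≠ 0 :=
      (Q.continuous.continuousAt.comp h℘c).eventually_ne hζQ
    filter_upwards [hopen.mem_nhds hζ, h2] with ξ h1 h2 using ⟨h1, h2⟩
  set W : Set ℂ := V ∩ (fun ζ ↦ ζ + l) ⁻¹' V with hW
  have hWopen : IsOpen W := hVopen.inter (hVopen.preimage (by fun_prop))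
  have hWdense : Dense W := by
    have hcount : Wᶜ.Countable := by
      rw [hW, compl_inter]
      refine hVcount.union ?_
      have : ((fun ζ : ℂ ↦ ζ + l) ⁻¹' V)ᶜ = (fun ζ : ℂ ↦ ζ - l) '' Vᶜ := by
        ext ζ
        simp only [mem_compl_iff, mem_preimage, mem_image]
        constructor
        · intro h
          exact ⟨ζ + l, h, by ring⟩
        · rintro ⟨ξ, hξ, rfl⟩
          simpa using hξ
      rw [this]
      exact hVcount.image _
    simpa using hcount.dense_compl ℝ
  obtain ⟨ζ₁, hζ₁O, hζ₁W⟩ : (O ∩ W).Nonempty :=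
    hWdense.inter_open_nonempty O hOopen ⟨z₀, hz₀, hQz₀⟩
  have hper : ∀ᶠ w in 𝓝 (c' + α * ζ₁), ℘[L] (α * l + w) = ℘[L] w := by
    have hOW : O ∩ W ∈ 𝓝 ζ₁ := (hOopen.inter hWopen).mem_nhds ⟨hζ₁O, hζ₁W⟩
    have hcont : ContinuousAt (fun w : ℂ ↦ (w - c') / α) (c' + α * ζ₁) := by fun_prop
    have e0 : (c' + α * ζ₁ - c') / α = ζ₁ := by
      rw [add_sub_cancel_left, mul_div_cancel_left₀ _ hα]
    have hpre := hcont.preimage_mem_nhds (by rw [e0]; exact hOW)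
    filter_upwards [hpre] with w hw
    obtain ⟨ζ, rfl⟩ : ∃ ζ, w = c' + α * ζ := ⟨(w - c') / α, by rw [mul_div_cancel₀ _ hα]; ring⟩
    have e0' : (c' + α * ζ - c') / α = ζ := by
      rw [add_sub_cancel_left, mul_div_cancel_left₀ _ hα]
    have hw' : ζ ∈ O ∩ W := by simpa only [mem_preimage, e0'] using hw
    obtain ⟨⟨-, hQζ⟩, hζV, hζV'⟩ := hw'
    have hpl : ℘[L] (ζ + l) = ℘[L] ζ := by simpa using L.weierstrassP_add_coe ζ ⟨l, hl⟩
    have e1 := hGV hζV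
    have e2 := hGV hζV'
    simp only [hG, hpl, sub_eq_zero] at e1 e2
    rw [show α * l + (c' + α * ζ) = c' + α * (ζ + l) by ring]
    exact mul_right_cancel₀ hQζ (e2.symm.trans e1)
  -- Step 5: a local translation symmetry of `℘` is a period
  refine L.mem_lattice_of_weierstrassP_add_eventuallyEq hζ₁W.1.2 ?_ hper
  have := hζ₁W.2.2
  rwa [show c' + α * (ζ₁ + l) = α * l + (c' + α * ζ₁) by ring] at this

end PeriodPair

end
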